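import Mathlib
import Summits.AtomisticToContinuum.HydrodynamicLimit.Theorems.InformationPercolationEngineKickFairRelEquilibriumMesoConditionThePastDefs
import Literature.MathematicalPhysics.KineticTheory.LocalGibbsConstEquivalence
import HarnessLib

/-!
# `KickFairRelEquilibriumMeso`, line `condition-the-past` — TF is its `κ`-free, `LG`-only form:
# `truncatedFluctuation_iff_centredLG`

Prover file (`--supports stmt-AtomisticToContinuum-15177`) for the registered sub-goal
`truncatedFluctuation_iff_centredLG : ∀ rseq, TruncatedFluctuation rseq ↔ TruncatedFluctuationLG rseq` of the line
`condition-the-past` (lead c7, wave 2) of the crux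
`Summit.AtomisticToContinuum.HydrodynamicLimit.Theses.InformationPercolationEngine.KickFairRelEquilibriumMeso`.

The two predicates (`…ConditionThePastDefs`, rev 2) have IDENTICAL quantifier prefixes; their integrands differ only in
the last factor of each summand, `kickDev − betaLG` (TF) versus `centredKickLG` (TF in `LG`-only form), and these agree
`LG`-a.e. for every `(i, n)` (`kickDev_sub_betaLG_ae_eq`, which needs the continuous positive profiles of the prefix and
`σ ≤ 1/2`), hence SIMULTANEOUSLY for all `(i, n)` (`ae_all_iff` twice: `Fin (N+1)` and `ℕ` are countable). On that
conull set the two finite double sums coincide term by term, so the two `L¹(LG)` sizes are equal (`lintegral_congr_ae`):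
`lintegral_truncFluct_eq_centredLG`. Transport in each direction: from the hypothesis get `σ₀`, answer with
`min σ₀ (1/2)` (so that `σ ≤ 1/2` is available), keep `N₀`, and rewrite the lintegral.
-/

noncomputable section

open MeasureTheory Set Filter Topology
open scoped ENNReal Classical

namespace Summit.AtomisticToContinuum.HydrodynamicLimit.Theorems.KickFairRelEquilibriumMesoLine

open Literature.Analysis.FluidPDE Literature.MathematicalPhysics.KineticTheory

variable {σ : ℝ} {N : ℕ}

/-- **`D − β = centredKickLG` simultaneously for all kicks, `LG`-a.e.**: the per-`(i, n)` identity
`kickDev_sub_betaLG_ae_eq` holds on ONE conull set for all `i : Fin (N+1)` and `n : ℕ` (countably many indices,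
`ae_all_iff`). [folklore] -/
theorem ae_forall_kickDev_sub_betaLG_eq_centredKickLG (hσ2 : σ ≤ 1 / 2) (Φ : Flow σ N) {a₀ θ₀ : T3 → ℝ}
    {u₀ : T3 → V3} (ha : Continuous a₀) (hθ : Continuous θ₀) (hu : Continuous u₀) (ha0 : ∀ x, 0 < a₀ x)
    (hθ0 : ∀ x, 0 < θ₀ x) (r : ℝ) {g : V3 × V3 × V3 → ℝ} (hg : Continuous g) (hgb : ∃ C : ℝ, ∀ p, |g p| ≤ C) :
    ∀ᵐ z ∂(localGibbsLaw σ a₀ u₀ θ₀ N Φ), ∀ i : Fin (N + 1), ∀ n : ℕ,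
      kickDev Φ r g i n z - betaLG σ a₀ θ₀ u₀ Φ r g i n z = centredKickLG σ a₀ θ₀ u₀ Φ r g i n z := by
  rw [ae_all_iff]; intro i
  rw [ae_all_iff]; intro n
  exact kickDev_sub_betaLG_ae_eq σ N a₀ θ₀ u₀ ha hθ hu ha0 hθ0 hσ2 Φ r g hg hgb i n

/-- **The TF integrand and its `κ`-free form have the same `L¹(LG)` size** (any normalisation `c`, any index cut
`a`, any index ranges `K z i`, any weights `h`): on the conull set of
`ae_forall_kickDev_sub_betaLG_eq_centredKickLG` the two finite double sums agree term by term, so the two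
lintegrals are equal (`lintegral_congr_ae`). [folklore] -/
theorem lintegral_truncFluct_eq_centredLG (hσ2 : σ ≤ 1 / 2) (Φ : Flow σ N) {a₀ θ₀ : T3 → ℝ}
    {u₀ : T3 → V3} (ha : Continuous a₀) (hθ : Continuous θ₀) (hu : Continuous u₀) (ha0 : ∀ x, 0 < a₀ x)
    (hθ0 : ∀ x, 0 < θ₀ x) (r : ℝ) {g : V3 × V3 × V3 → ℝ} (hg : Continuous g) (hgb : ∃ C : ℝ, ∀ p, |g p| ≤ C)
    (c a : ℝ) (K : Phase N → Fin (N + 1) → ℕ) (h : Fin (N + 1) → ℕ → Past N → ℝ) :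
    ∫⁻ z, ENNReal.ofReal |c * ∑ i : Fin (N + 1), ∑ n ∈ Finset.range (K z i),
        (if (n : ℝ) < a then (1 : ℝ) else 0) *
          (h i n (past Φ r z i n) * (kickDev Φ r g i n z - betaLG σ a₀ θ₀ u₀ Φ r g i n z))|
      ∂(localGibbsLaw σ a₀ u₀ θ₀ N Φ) =
    ∫⁻ z, ENNReal.ofReal |c * ∑ i : Fin (N + 1), ∑ n ∈ Finset.range (K z i),
        (if (n : ℝ) < a then (1 : ℝ) else 0) *
          (h i n (past Φ r z i n) * centredKickLG σ a₀ θ₀ u₀ Φ r g i n z)|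
      ∂(localGibbsLaw σ a₀ u₀ θ₀ N Φ) := by
  apply lintegral_congr_ae
  filter_upwards [ae_forall_kickDev_sub_betaLG_eq_centredKickLG hσ2 Φ ha hθ hu ha0 hθ0 r hg hgb] with z hz
  have hsum : (∑ i : Fin (N + 1), ∑ n ∈ Finset.range (K z i),
        (if (n : ℝ) < a then (1 : ℝ) else 0) *
          (h i n (past Φ r z i n) * (kickDev Φ r g i n z - betaLG σ a₀ θ₀ u₀ Φ r g i n z))) =
      ∑ i : Fin (N + 1), ∑ n ∈ Finset.range (K z i),
        (if (n : ℝ) < a then (1 : ℝ) else 0) *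
          (h i n (past Φ r z i n) * centredKickLG σ a₀ θ₀ u₀ Φ r g i n z) := by
    refine Finset.sum_congr rfl fun i _ => Finset.sum_congr rfl fun n _ => ?_
    rw [hz i n]
  simp only [hsum]

/-- **TF is equivalent to its `κ`-free, `LG`-only form** (registered sub-goal `truncatedFluctuation_iff_centredLG`):
the two predicates have identical prefixes and, for `σ ≤ 1/2` and continuous positive profiles, equal `L¹(LG)`
sizes (`lintegral_truncFluct_eq_centredLG`); in each direction answer with `σ₀ := min σ₀ (1/2)` and the same `N₀`.
[folklore] -/
theorem truncatedFluctuation_iff_centredLG : ∀ rseq : ℕ → ℝ, TruncatedFluctuation rseq ↔ TruncatedFluctuationLG rseq := by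
  intro rseq
  constructor
  · intro hTF a₀ θ₀ u₀ ha hθ hu ha0 hθ0
    obtain ⟨σ₀, hσ₀, H⟩ := hTF a₀ θ₀ u₀ ha hθ hu ha0 hθ0
    refine ⟨min σ₀ (1 / 2), lt_min hσ₀ one_half_pos, ?_⟩
    intro σ hσ hσlt Φ τ hτ g hg hgb A hA δ hδ
    obtain ⟨N₀, hN₀⟩ := H σ hσ (hσlt.trans_le (min_le_left _ _)) Φ τ hτ g hg hgb A hA δ hδ
    refine ⟨N₀, fun N hN h hhm hhb => ?_⟩
    have hσ2 : σ ≤ 1 / 2 := (hσlt.trans_le (min_le_right _ _)).le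
    rw [← lintegral_truncFluct_eq_centredLG hσ2 (Φ N) ha hθ hu ha0 hθ0 (rseq N) hg hgb
      (hsDiameter σ N / ((N : ℝ) + 1)) (A * ((N : ℝ) + 1) ^ (1 / 3 : ℝ)) (fun z i => cnt (Φ N) τ z i) h]
    exact hN₀ N hN h hhm hhb
  · intro hTF a₀ θ₀ u₀ ha hθ hu ha0 hθ0
    obtain ⟨σ₀, hσ₀, H⟩ := hTF a₀ θ₀ u₀ ha hθ hu ha0 hθ0
    refine ⟨min σ₀ (1 / 2), lt_min hσ₀ one_half_pos, ?_⟩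
    intro σ hσ hσlt Φ τ hτ g hg hgb A hA δ hδ
    obtain ⟨N₀, hN₀⟩ := H σ hσ (hσlt.trans_le (min_le_left _ _)) Φ τ hτ g hg hgb A hA δ hδ
    refine ⟨N₀, fun N hN h hhm hhb => ?_⟩
    have hσ2 : σ ≤ 1 / 2 := (hσlt.trans_le (min_le_right _ _)).le
    rw [lintegral_truncFluct_eq_centredLG hσ2 (Φ N) ha hθ hu ha0 hθ0 (rseq N) hg hgb
      (hsDiameter σ N / ((N : ℝ) + 1)) (A * ((N : ℝ) + 1) ^ (1 / 3 : ℝ)) (fun z i => cnt (Φ N) τ z i) h]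
    exact hN₀ N hN h hhm hhb

end Summit.AtomisticToContinuum.HydrodynamicLimit.Theorems.KickFairRelEquilibriumMesoLine

end
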